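import Mathlib
import Summits.QuantumFields.YangMills.Theses.F4SubCurvatureDoor
import Summits.QuantumFields.YangMills.Theorems.RationalShortRootRigidityPlanarAssembly
import Summits.QuantumFields.YangMills.Theorems.RationalShortRootRigidityRadialOfPlaneRotation
import Summits.QuantumFields.YangMills.Theorems.RationalShortRootRigidityAlternationStub

/-!
# `RationalShortRootRigidity` — the crux from Step 1 (composition of the landed Steps 2–4)

Crux `stmt-QuantumFields-23124` (`F4SubCurvatureDoor.RationalShortRootRigidity`, LINE g15-A of planner ym-idea-3).  The birth
skeleton HOME l15/RationalShortRootRigidity-birth.lean proves the crux from four stubs by the kernel-checked composition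
`RationalShortRootRigidity_of`.  Three of the four stubs are tree theorems:

* Step 2 `stub_planar` = `RationalShortRootRigidity.stub_planar` (p672469, seat frs-p2),
* Step 3 `stub_so4` = `RationalShortRootRigidity.radial_of_b4Inv_of_planeRotInv` (p660676),
* Step 4 `stub_alternation` = `RationalShortRootRigidity.Alternation.stub_alternation` (p672906).

**Theorem** (`rationalShortRootRigidity_of_reduce`).  Step 1 (`stub_reduce`, its statement VERBATIM with the skeleton's
abbreviations unfolded, taken as a HYPOTHESIS) ⇒ the route declaration
`Summit.QuantumFields.YangMills.Theses.F4SubCurvatureDoor.RationalShortRootRigidity` BY NAME.  The proof is the skeleton's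
composition with the three landed theorems instantiated; once Step 1 lands as a theorem `T`, the crux is
`rationalShortRootRigidity_of_reduce T` (one line, `--workitem stmt-QuantumFields-23124`).

Mathlib + tree theorems; THEOREMS ONLY (no definitions; the hypothesis is an implication, not a named fact); no `sorry`; default
heartbeats.  HONEST LABEL: conditional on Step 1; the crux 23124 is NOT closed by this file; 23124 itself is the BC5 rung of crux
23035 in the rational class — no LADDER-YM rung and no Yang–Mills mass gap follow.  Free-hands width seat `ym-line-sfw-p2-w4` g18,
`--supports stmt-QuantumFields-23124`.
-/

set_option autoImplicit false

namespace Summit.QuantumFields.YangMills.Theorems.RationalShortRootRigidity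

open scoped BigOperators Polynomial

/-- **Step 1 ⇒ the crux.**  The hypothesis is the birth skeleton's `stub_reduce` VERBATIM (abbreviations unfolded); the conclusion
is the route declaration BY NAME. [folklore] -/
theorem rationalShortRootRigidity_of_reduce
    (h1 : ∀ N D : MvPolynomial (Fin 4) ℝ,
      (∀ (σ : Equiv.Perm (Fin 4)) (ε : Fin 4 → ℝ), (∀ i, ε i = 1 ∨ ε i = -1) →
        ∀ p : Fin 4 → ℝ, MvPolynomial.eval (fun i => ε i * p (σ i)) N = MvPolynomial.eval p N) →
      (∀ (σ : Equiv.Perm (Fin 4)) (ε : Fin 4 → ℝ), (∀ i, ε i = 1 ∨ ε i = -1) →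
        ∀ p : Fin 4 → ℝ, MvPolynomial.eval (fun i => ε i * p (σ i)) D = MvPolynomial.eval p D) →
      (∀ p : Fin 4 → ℝ, MvPolynomial.eval (fun i => p i - (∑ j, p j) / 2) N = MvPolynomial.eval p N) →
      (∀ p : Fin 4 → ℝ, MvPolynomial.eval (fun i => p i - (∑ j, p j) / 2) D = MvPolynomial.eval p D) →
      MvPolynomial.coeff (Finsupp.single 0 D.totalDegree) D ≠ 0 →
      N.totalDegree ≤ D.totalDegree + 2 →
      (∀ q : Fin 3 → ℝ, q ≠ 0 → ∃ (k : ℕ) (ω r : Fin k → ℝ) (c : Polynomial ℝ),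
        (∀ j, 0 < ω j) ∧ (∀ j, 0 ≤ r j) ∧
        ∀ t : ℝ, MvPolynomial.eval (Fin.cons t q) N =
          MvPolynomial.eval (Fin.cons t q) D * (c.eval (t ^ 2) + ∑ j, r j / (t ^ 2 + ω j ^ 2))) →
      ∃ N₀ D₀ : MvPolynomial (Fin 4) ℝ, N * D₀ = D * N₀ ∧ D₀ ≠ 0 ∧
        (∀ (σ : Equiv.Perm (Fin 4)) (ε : Fin 4 → ℝ), (∀ i, ε i = 1 ∨ ε i = -1) →
          ∀ p : Fin 4 → ℝ, MvPolynomial.eval (fun i => ε i * p (σ i)) N₀ = MvPolynomial.eval p N₀) ∧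
        (∀ (σ : Equiv.Perm (Fin 4)) (ε : Fin 4 → ℝ), (∀ i, ε i = 1 ∨ ε i = -1) →
          ∀ p : Fin 4 → ℝ, MvPolynomial.eval (fun i => ε i * p (σ i)) D₀ = MvPolynomial.eval p D₀) ∧
        (∀ p : Fin 4 → ℝ, MvPolynomial.eval (fun i => p i - (∑ j, p j) / 2) N₀ = MvPolynomial.eval p N₀) ∧
        (∀ p : Fin 4 → ℝ, MvPolynomial.eval (fun i => p i - (∑ j, p j) / 2) D₀ = MvPolynomial.eval p D₀) ∧
        MvPolynomial.coeff (Finsupp.single 0 D₀.totalDegree) D₀ ≠ 0 ∧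
        N₀.totalDegree ≤ D₀.totalDegree + 2 ∧
        (∀ q : Fin 3 → ℝ, q ≠ 0 → ∃ (k : ℕ) (ω r : Fin k → ℝ) (c : Polynomial ℝ),
          (∀ j, 0 < ω j) ∧ (∀ j, 0 ≤ r j) ∧
          ∀ t : ℝ, MvPolynomial.eval (Fin.cons t q) N₀ =
            MvPolynomial.eval (Fin.cons t q) D₀ * (c.eval (t ^ 2) + ∑ j, r j / (t ^ 2 + ω j ^ 2))) ∧
        (∀ q : Fin 4 → ℝ, (∑ i, q i * (fun i : Fin 4 => if i = 0 then (1 : ℝ) else 0) i) = 0 →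
          ∀ z : ℂ, MvPolynomial.aeval (fun i => z * ((fun i : Fin 4 => if i = 0 then (1 : ℝ) else 0) i : ℂ) + (q i : ℂ)) D₀ = 0 →
            z.re = 0) ∧
        (∀ q : Fin 4 → ℝ, (∑ i, q i * (fun _ : Fin 4 => (1 : ℝ) / 2) i) = 0 →
          ∀ z : ℂ, MvPolynomial.aeval (fun i => z * ((fun _ : Fin 4 => (1 : ℝ) / 2) i : ℂ) + (q i : ℂ)) D₀ = 0 →
            z.re = 0)) :
    Summit.QuantumFields.YangMills.Theses.F4SubCurvatureDoor.RationalShortRootRigidity := by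
  intro N D hB hH hfull hdeg hSt
  classical
  -- Step 1: the reduced pair
  obtain ⟨N₀, D₀, hND, hD0, hBN₀, hBD₀, hHN₀, hHD₀, hfull₀, hdeg₀, hSt₀, hW0, hWh⟩ :=
    h1 N D (fun σ ε hε p => (hB σ ε hε p).1) (fun σ ε hε p => (hB σ ε hε p).2) (fun p => (hH p).1)
      (fun p => (hH p).2) hfull hdeg hSt
  -- Step 2: the planar lemma; Step 3: so(4); Step 4: alternation
  have hrot := stub_planar D₀ hBD₀ hHD₀ hfull₀ hW0 hWh
  have hrad := radial_of_b4Inv_of_planeRotInv D₀ hBD₀ hrot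
  obtain ⟨F, G, hG, hid⟩ := Alternation.stub_alternation N₀ D₀ hBN₀ hHN₀ hD0 hrad hdeg₀ hSt₀
  refine ⟨F, G, hG, ?_⟩
  -- lift the pointwise identity for (N₀, D₀) to a polynomial identity, cancel D₀, evaluate
  set S : MvPolynomial (Fin 4) ℝ := ∑ i : Fin 4, (MvPolynomial.X i : MvPolynomial (Fin 4) ℝ) ^ 2 with hS
  have hpoly : N₀ * Polynomial.aeval S G = D₀ * Polynomial.aeval S F := by
    apply MvPolynomial.funext
    intro p
    rw [map_mul, map_mul, hS, Alternation.eval_aeval_sumSq, Alternation.eval_aeval_sumSq]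
    exact hid p
  have hpoly2 : D₀ * (N * Polynomial.aeval S G) = D₀ * (D * Polynomial.aeval S F) := by
    calc D₀ * (N * Polynomial.aeval S G) = (N * D₀) * Polynomial.aeval S G := by ring
      _ = (D * N₀) * Polynomial.aeval S G := by rw [hND]
      _ = D * (N₀ * Polynomial.aeval S G) := by ring
      _ = D * (D₀ * Polynomial.aeval S F) := by rw [hpoly]
      _ = D₀ * (D * Polynomial.aeval S F) := by ring
  have hcancel : N * Polynomial.aeval S G = D * Polynomial.aeval S F := mul_left_cancel₀ hD0 hpoly2
  intro p
  have h := congrArg (MvPolynomial.eval p) hcancel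
  rw [map_mul, map_mul, hS, Alternation.eval_aeval_sumSq, Alternation.eval_aeval_sumSq] at h
  exact h

end Summit.QuantumFields.YangMills.Theorems.RationalShortRootRigidity
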